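import Summits.CriticalPhenomena.PercolationContinuityZ3.Theorems.PercNearOneGluingNoHeavyLowerTailQ44bPencilTools
import Summits.CriticalPhenomena.PercolationContinuityZ3.Theorems.PercNearOneGluingNoHeavyLowerTailQ44bCrossPendantExchange
import Literature.Probability.Percolation.KozmaNitzanSeparatingTriple
import HarnessLib

/-!
# Gluing a pair between the clusters of `a` and `b`: the cells of `Q44b` after `ω ↦ ω ∪ {s(x,z)}` (tools)

Support file for crux `stmt-CriticalPhenomena-4575` (master-family programme, quadratic four-point row `Q44b` of
`prim-bnk-1` gen 13, OPEN for all `n`), seat `prim-l12-p6` gen 12; memo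
`run/shared/lean/prim/prim-l12/FROM-prim-l12-p6-g12-K8-CENSUS.md` §7.

The reductions of the tree (`Q44b.row_nonneg_of_pencilConcave`, gen 7; `Q44b.row_nonneg_of_mixedAt`, gen 8) ask for
pencil concavity (`Q44b.PencilConcave`) resp. a nonnegative mixed Bernstein coefficient (`Q44b.PencilMixed`) along the
pencil of EVERY pair `s(x,z)` whose end `x` is surely joined to the terminal `a`.  Gen 7 proved the four-point
inequality behind the case "`z` is the terminal `b`" (`Q44bExchange.crossPendant_exchange_sum`, the crossing-to-pendant
exchange) but not the link to the pencil.  This file supplies the link, through the gluing identity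
`P_{w[e↦1]}(E) = P_{w[e↦0]}({ω : ω ∪ {e} ∈ E})` and the one-extra-edge reachability lemma:

THIS FILE (tools for `…Q44bPencilAtB.lean`): `Q44b.bil_eq_zero_of_conn_ab_right` (the bilinear form vanishes when
`a ~ b` a.s. in the second copy), `Q44b.sureJoined_ab_of_pair`, the one-extra-edge lemma `Q44b.reachable_insert_iff_ab`
(on `{a~x} ∩ {b~z}`, reachability in `ω ∪ {s(x,z)}`), the pointwise description of the events `AC`, `AΔ`, `ab|c|y`,
`a|bcy` after the gluing (`Q44b.insert_mem_evAC_iff`, `…evAD_iff`, `…evAB_iff`, `Q44b.insert_not_mem_evPend`), and the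
cell bookkeeping identities (`{c~y} = AC ⊔ C¬A`, `X = ac|by ⊔ ay|bc`, …) in the set forms used by
`Q44bExchange.crossPendant_exchange_sum`.  Theorems only; no named facts, no sorries, standard axioms.
-/

noncomputable section

namespace Summit.CriticalPhenomena.PercolationContinuityZ3.Theorems

namespace Q44b

open MeasureTheory Set Literature.Probability.LatticeModels Literature.Probability.Percolation
open scoped Classical

variable {n : ℕ}

/-- Membership in `{u ↔ v}` (by `Iff.rfl`; local copy, cf. `knThm2_mem_openConn`). [folklore] -/
private theorem mem_openConn_iff'  (ω : BondConfig (Fin n)) (u v : Fin n) :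
    ω ∈ (openConn u v : Set (BondConfig (Fin n))) ↔ (openGraph ω).Reachable u v := Iff.rfl

/-! ### Vanishing of the bilinear form when `a ~ b` almost surely in the SECOND weighting -/

/-- `bil w w' = 0` as soon as `a` is almost surely joined to `b` under the second weighting `w'`: every second
factor (`∅`, `X`, `C¬A`, `X′`) lies inside `{a ≁ b}`. [this work] -/
theorem bil_eq_zero_of_conn_ab_right (w w' : Sym2 (Fin n) → unitInterval) (a b c y : Fin n)
    (hw' : (prodBernoulli w').real (openConn a b) = 1) : bil w w' a b c y = 0 := by
  unfold bil
  have cw' : (prodBernoulli w').real (openConn a b)ᶜ = 0 := by rw [real_compl, hw']; ring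
  have e1 : (prodBernoulli w').real (evEmp a b c y) = 0 :=
    real_eq_zero_of_subset w' (fun ω hω => hω.1.1.1.1.1) cw'
  have e2 : (prodBernoulli w').real (evX a b c y) = 0 :=
    real_eq_zero_of_subset w' (fun ω hω => hω.1) cw'
  have e3 : (prodBernoulli w').real (evCnA a b c y) = 0 :=
    real_eq_zero_of_subset w' (fun ω hω => hω.2) cw'
  have e4 : (prodBernoulli w').real (evXp a b c y) = 0 :=
    real_eq_zero_of_subset w' (fun ω hω => hω.1) cw'
  rw [e1, e2, e3, e4]; ring

/-- Raising the weight of `s(x,z)` to one joins `a` surely to `b` when `x ∈ [a]` and `z ∈ [b]`. [folklore] -/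
theorem sureJoined_ab_of_pair (w : Sym2 (Fin n) → unitInterval) {a b x z : Fin n} (hxz : x ≠ z)
    (hx : sureJoined (Function.update w s(x, z) 0) a x) (hz : sureJoined (Function.update w s(x, z) 0) b z) :
    sureJoined (Function.update w s(x, z) 1) a b := by
  have hx1 : sureJoined (Function.update w s(x, z) 1) a x := by
    have := sureJoined_update_one (Function.update w s(x, z) 0) s(x, z) hx
    rwa [Function.update_idem] at this
  have hz1 : sureJoined (Function.update w s(x, z) 1) b z := by
    have := sureJoined_update_one (Function.update w s(x, z) 0) s(x, z) hz
    rwa [Function.update_idem] at this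
  have hxz1 : sureJoined (Function.update w s(x, z) 1) x z := by
    apply SimpleGraph.Adj.reachable
    rw [SimpleGraph.fromEdgeSet_adj]
    exact ⟨by simp, hxz⟩
  unfold sureJoined at *
  exact (hx1.trans hxz1).trans hz1.symm

/-! ### One extra edge between the clusters of `a` and `b` -/

/-- With `a ~ x` and `b ~ z` open in `ω`, reachability in `ω ∪ {s(x,z)}` is reachability in `ω` or through the
pair of clusters of `a` and `b`. [folklore; from `KNSep.reachable_insert_iff`] -/
theorem reachable_insert_iff_ab (ω : BondConfig (Fin n)) {a b x z : Fin n}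
    (hax : (openGraph ω).Reachable a x) (hbz : (openGraph ω).Reachable b z) (t t' : Fin n) :
    (openGraph (insert s(x, z) ω)).Reachable t t' ↔
      (openGraph ω).Reachable t t' ∨ ((openGraph ω).Reachable t a ∧ (openGraph ω).Reachable b t') ∨
        ((openGraph ω).Reachable t b ∧ (openGraph ω).Reachable a t') := by
  rw [KNSep.reachable_insert_iff ω x z t t']
  have h1 : (openGraph ω).Reachable t x ↔ (openGraph ω).Reachable t a :=
    ⟨fun h => h.trans hax.symm, fun h => h.trans hax⟩
  have h2 : (openGraph ω).Reachable z t' ↔ (openGraph ω).Reachable b t' :=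
    ⟨fun h => hbz.trans h, fun h => hbz.symm.trans h⟩
  have h3 : (openGraph ω).Reachable t z ↔ (openGraph ω).Reachable t b :=
    ⟨fun h => h.trans hbz.symm, fun h => h.trans hbz⟩
  have h4 : (openGraph ω).Reachable x t' ↔ (openGraph ω).Reachable a t' :=
    ⟨fun h => hax.trans h, fun h => hax.symm.trans h⟩
  rw [h1, h2, h3, h4]

/-! ### The events after gluing (pointwise, on `{a ~ x} ∩ {b ~ z}`) -/

section pointwise

variable (ω : BondConfig (Fin n)) {a b c y x z : Fin n}

/-- After adding `s(x,z)`: `AC` becomes `{c~y} ∪ {a~c, b~y} ∪ {a~y, b~c}`. [this work] -/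
theorem insert_mem_evAC_iff (hax : (openGraph ω).Reachable a x) (hbz : (openGraph ω).Reachable b z) :
    insert s(x, z) ω ∈ evAC a b c y ↔
      ω ∈ (openConn c y ∪ (openConn a c ∩ openConn b y ∪ openConn a y ∩ openConn b c) :
        Set (BondConfig (Fin n))) := by
  simp only [evAC, mem_inter_iff, mem_union, mem_openConn_iff', reachable_insert_iff_ab ω hax hbz]
  constructor
  · rintro ⟨-, h⟩
    rcases h with h | ⟨h1, h2⟩ | ⟨h1, h2⟩
    · exact Or.inl h
    · exact Or.inr (Or.inl ⟨h1.symm, h2⟩)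
    · exact Or.inr (Or.inr ⟨h2, h1.symm⟩)
  · intro h
    refine ⟨Or.inr (Or.inl ⟨SimpleGraph.Reachable.refl _, SimpleGraph.Reachable.refl _⟩), ?_⟩
    rcases h with h | ⟨h1, h2⟩ | ⟨h1, h2⟩
    · exact Or.inl h
    · exact Or.inr (Or.inl ⟨h1.symm, h2⟩)
    · exact Or.inr (Or.inr ⟨h2.symm, h1⟩)

/-- After adding `s(x,z)`: `AΔ` becomes `{a,b} ↮ {c,y}`. [this work] -/
theorem insert_mem_evAD_iff (hax : (openGraph ω).Reachable a x) (hbz : (openGraph ω).Reachable b z) :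
    insert s(x, z) ω ∈ evAD a b c y ↔
      ω ∈ ((openConn a c)ᶜ ∩ (openConn b c)ᶜ ∩ (openConn a y)ᶜ ∩ (openConn b y)ᶜ :
        Set (BondConfig (Fin n))) := by
  simp only [evAD, mem_inter_iff, mem_compl_iff, mem_openConn_iff', reachable_insert_iff_ab ω hax hbz]
  constructor
  · rintro ⟨⟨-, hc⟩, hy⟩
    exact ⟨⟨⟨fun h => hc (Or.inl h), fun h => hc (Or.inr (Or.inl ⟨SimpleGraph.Reachable.refl _, h⟩))⟩,
      fun h => hy (Or.inl h)⟩, fun h => hy (Or.inr (Or.inl ⟨SimpleGraph.Reachable.refl _, h⟩))⟩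
  · rintro ⟨⟨⟨hac, hbc⟩, hay⟩, hby⟩
    refine ⟨⟨Or.inr (Or.inl ⟨SimpleGraph.Reachable.refl _, SimpleGraph.Reachable.refl _⟩), ?_⟩, ?_⟩
    · rintro (h | ⟨-, h⟩ | ⟨-, h⟩)
      · exact hac h
      · exact hbc h
      · exact hac h
    · rintro (h | ⟨-, h⟩ | ⟨-, h⟩)
      · exact hay h
      · exact hby h
      · exact hay h

/-- After adding `s(x,z)`: `ab|c|y` becomes `{a,b} ↮ {c,y} ∧ c ≁ y`. [this work] -/
theorem insert_mem_evAB_iff (hax : (openGraph ω).Reachable a x) (hbz : (openGraph ω).Reachable b z) :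
    insert s(x, z) ω ∈ evAB a b c y ↔
      ω ∈ ((openConn a c)ᶜ ∩ (openConn b c)ᶜ ∩ (openConn a y)ᶜ ∩ (openConn b y)ᶜ ∩ (openConn c y)ᶜ :
        Set (BondConfig (Fin n))) := by
  simp only [evAB, mem_inter_iff, mem_compl_iff, mem_openConn_iff', reachable_insert_iff_ab ω hax hbz]
  constructor
  · rintro ⟨⟨⟨-, hc⟩, hy⟩, hcy⟩
    exact ⟨⟨⟨⟨fun h => hc (Or.inl h), fun h => hc (Or.inr (Or.inl ⟨SimpleGraph.Reachable.refl _, h⟩))⟩,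
      fun h => hy (Or.inl h)⟩, fun h => hy (Or.inr (Or.inl ⟨SimpleGraph.Reachable.refl _, h⟩))⟩,
      fun h => hcy (Or.inl h)⟩
  · rintro ⟨⟨⟨⟨hac, hbc⟩, hay⟩, hby⟩, hcy⟩
    refine ⟨⟨⟨Or.inr (Or.inl ⟨SimpleGraph.Reachable.refl _, SimpleGraph.Reachable.refl _⟩), ?_⟩, ?_⟩, ?_⟩
    · rintro (h | ⟨-, h⟩ | ⟨-, h⟩)
      · exact hac h
      · exact hbc h
      · exact hac h
    · rintro (h | ⟨-, h⟩ | ⟨-, h⟩)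
      · exact hay h
      · exact hby h
      · exact hay h
    · rintro (h | ⟨h, -⟩ | ⟨h, -⟩)
      · exact hcy h
      · exact hac h.symm
      · exact hbc h.symm

/-- After adding `s(x,z)`: `a|bcy` becomes impossible (`a ~ b`). [this work] -/
theorem insert_not_mem_evPend (hax : (openGraph ω).Reachable a x) (hbz : (openGraph ω).Reachable b z) :
    insert s(x, z) ω ∉ evPend a b c y := by
  intro h
  have hab : (openGraph (insert s(x, z) ω)).Reachable a b := by
    rw [reachable_insert_iff_ab ω hax hbz]
    exact Or.inr (Or.inl ⟨SimpleGraph.Reachable.refl _, SimpleGraph.Reachable.refl _⟩)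
  exact absurd hab h.1.1.1.1

end pointwise

/-! ### Set identities among the cells (reachability bookkeeping) -/

section cells

variable (a b c y : Fin n)

/-- `{c~y} ∪ {a~c,b~y} ∪ {a~y,b~c} = {c~y} ⊔ X` (on `X` one has `a ≁ b` and `c ≁ y`). [this work] -/
theorem union_AC_eq :
    (openConn c y ∪ (openConn a c ∩ openConn b y ∪ openConn a y ∩ openConn b c) : Set (BondConfig (Fin n))) =
      openConn c y ∪ evX a b c y := by
  ext ω
  simp only [evX, mem_union, mem_inter_iff, mem_compl_iff, mem_openConn_iff']
  constructor
  · rintro (h | h)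
    · exact Or.inl h
    · by_cases hcy : (openGraph ω).Reachable c y
      · exact Or.inl hcy
      · refine Or.inr ⟨?_, h⟩
        intro hab
        rcases h with ⟨hac, hby⟩ | ⟨hay, hbc⟩
        · exact hcy ((hac.symm.trans hab).trans hby)
        · exact hcy ((hbc.symm.trans hab.symm).trans hay)
  · rintro (h | ⟨-, h⟩)
    · exact Or.inl h
    · exact Or.inr h

/-- `X ⊆ {c ≁ y}`. [this work] -/
theorem disjoint_cy_evX : Disjoint (openConn c y : Set (BondConfig (Fin n))) (evX a b c y) := by
  rw [Set.disjoint_left]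
  intro ω hcy hX
  simp only [evX, mem_inter_iff, mem_union, mem_compl_iff, mem_openConn_iff'] at hcy hX
  obtain ⟨hab, h⟩ := hX
  rcases h with ⟨hac, hby⟩ | ⟨hay, hbc⟩
  · exact hab ((hac.trans hcy).trans hby.symm)
  · exact hab ((hay.trans hcy.symm).trans hbc.symm)

/-- `{c~y} = AC ⊔ C¬A`. [this work] -/
theorem cy_eq_AC_union_CnA :
    (openConn c y : Set (BondConfig (Fin n))) = evAC a b c y ∪ evCnA a b c y := by
  ext ω
  simp only [evAC, evCnA, mem_union, mem_inter_iff, mem_compl_iff]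
  tauto

/-- `AC` and `C¬A` are disjoint. [this work] -/
theorem disjoint_AC_CnA : Disjoint (evAC a b c y) (evCnA a b c y) := by
  rw [Set.disjoint_left]
  intro ω h1 h2
  exact absurd h1.1 h2.2

/-- `{a,b} ↮ {c,y}` splits along `a ~ b` into `AΔ` and its `a ≁ b` part. [this work] -/
theorem D4_eq :
    ((openConn a c)ᶜ ∩ (openConn b c)ᶜ ∩ (openConn a y)ᶜ ∩ (openConn b y)ᶜ :
        Set (BondConfig (Fin n))) =
      evAD a b c y ∪
        (((openConn a c)ᶜ ∩ (openConn b c)ᶜ ∩ (openConn a y)ᶜ ∩ (openConn b y)ᶜ :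
        Set (BondConfig (Fin n))) ∩ (openConn a b)ᶜ) := by
  ext ω
  simp only [evAD, mem_union, mem_inter_iff, mem_compl_iff, mem_openConn_iff']
  constructor
  · rintro ⟨⟨⟨hac, hbc⟩, hay⟩, hby⟩
    by_cases hab : (openGraph ω).Reachable a b
    · exact Or.inl ⟨⟨hab, hac⟩, hay⟩
    · exact Or.inr ⟨⟨⟨⟨hac, hbc⟩, hay⟩, hby⟩, hab⟩
  · rintro (⟨⟨hab, hac⟩, hay⟩ | ⟨h, -⟩)
    · exact ⟨⟨⟨hac, fun h => hac (hab.trans h)⟩, hay⟩, fun h => hay (hab.trans h)⟩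
    · exact h

/-- the two parts of the previous split are disjoint. [this work] -/
theorem disjoint_AD_rest :
    Disjoint (evAD a b c y)
      (((openConn a c)ᶜ ∩ (openConn b c)ᶜ ∩ (openConn a y)ᶜ ∩ (openConn b y)ᶜ :
        Set (BondConfig (Fin n))) ∩ (openConn a b)ᶜ) := by
  rw [Set.disjoint_left]
  intro ω h1 h2
  exact absurd h1.1.1 h2.2

/-- `{a,b} ↮ {c,y}, a ≁ b` = `∅ ⊔ a|b|cy` (the latter in the form used by `crossPendant_exchange_sum`).
[this work] -/
theorem D4_nab_eq :
    ((openConn a c)ᶜ ∩ (openConn b c)ᶜ ∩ (openConn a y)ᶜ ∩ (openConn b y)ᶜ :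
        Set (BondConfig (Fin n))) ∩ (openConn a b)ᶜ =
      evEmp a b c y ∪
        ((openConn a b)ᶜ ∩ (openConn a c)ᶜ ∩ (openConn a y)ᶜ ∩ openConn c y ∩ (openConn b y)ᶜ :
        Set (BondConfig (Fin n))) := by
  ext ω
  simp only [evEmp, mem_union, mem_inter_iff, mem_compl_iff, mem_openConn_iff']
  constructor
  · rintro ⟨⟨⟨⟨hac, hbc⟩, hay⟩, hby⟩, hab⟩
    by_cases hcy : (openGraph ω).Reachable c y
    · exact Or.inr ⟨⟨⟨⟨hab, hac⟩, hay⟩, hcy⟩, hby⟩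
    · exact Or.inl ⟨⟨⟨⟨⟨hab, hac⟩, hay⟩, hbc⟩, hby⟩, hcy⟩
  · rintro (⟨⟨⟨⟨⟨hab, hac⟩, hay⟩, hbc⟩, hby⟩, -⟩ | ⟨⟨⟨⟨hab, hac⟩, hay⟩, hcy⟩, hby⟩)
    · exact ⟨⟨⟨⟨hac, hbc⟩, hay⟩, hby⟩, hab⟩
    · exact ⟨⟨⟨⟨hac, fun h => hby (h.trans hcy)⟩, hay⟩, hby⟩, hab⟩

/-- `∅` and `a|b|cy` are disjoint. [this work] -/
theorem disjoint_Emp_Sab :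
    Disjoint (evEmp a b c y)
      ((openConn a b)ᶜ ∩ (openConn a c)ᶜ ∩ (openConn a y)ᶜ ∩ openConn c y ∩ (openConn b y)ᶜ :
        Set (BondConfig (Fin n))) := by
  rw [Set.disjoint_left]
  intro ω h1 h2
  exact absurd h2.1.2 h1.2

/-- `{a,b} ↮ {c,y}, c ≁ y` = `ab|c|y ⊔ ∅`. [this work] -/
theorem D4_ncy_eq :
    ((openConn a c)ᶜ ∩ (openConn b c)ᶜ ∩ (openConn a y)ᶜ ∩ (openConn b y)ᶜ :
        Set (BondConfig (Fin n))) ∩ (openConn c y)ᶜ =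
      evAB a b c y ∪ evEmp a b c y := by
  ext ω
  simp only [evAB, evEmp, mem_union, mem_inter_iff, mem_compl_iff, mem_openConn_iff']
  constructor
  · rintro ⟨⟨⟨⟨hac, hbc⟩, hay⟩, hby⟩, hcy⟩
    by_cases hab : (openGraph ω).Reachable a b
    · exact Or.inl ⟨⟨⟨hab, hac⟩, hay⟩, hcy⟩
    · exact Or.inr ⟨⟨⟨⟨⟨hab, hac⟩, hay⟩, hbc⟩, hby⟩, hcy⟩
  · rintro (⟨⟨⟨hab, hac⟩, hay⟩, hcy⟩ | ⟨⟨⟨⟨⟨-, hac⟩, hay⟩, hbc⟩, hby⟩, hcy⟩)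
    · exact ⟨⟨⟨⟨hac, fun h => hac (hab.trans h)⟩, hay⟩, fun h => hay (hab.trans h)⟩, hcy⟩
    · exact ⟨⟨⟨⟨hac, hbc⟩, hay⟩, hby⟩, hcy⟩

/-- `ab|c|y` and `∅` are disjoint. [this work] -/
theorem disjoint_AB_Emp : Disjoint (evAB a b c y) (evEmp a b c y) := by
  rw [Set.disjoint_left]
  intro ω h1 h2
  exact absurd h1.1.1.1 h2.1.1.1.1.1

/-- `X = ac|by ⊔ ay|bc` in the cell form of `crossPendant_exchange_sum`. [this work] -/
theorem evX_eq :
    evX a b c y =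
      ((openConn a b)ᶜ ∩ (openConn a y)ᶜ ∩ openConn a c ∩ openConn b y :
        Set (BondConfig (Fin n))) ∪
        ((openConn a b)ᶜ ∩ (openConn a c)ᶜ ∩ openConn a y ∩ openConn b c :
        Set (BondConfig (Fin n))) := by
  ext ω
  simp only [evX, mem_union, mem_inter_iff, mem_compl_iff, mem_openConn_iff']
  constructor
  · rintro ⟨hab, ⟨hac, hby⟩ | ⟨hay, hbc⟩⟩
    · exact Or.inl ⟨⟨⟨hab, fun h => hab (h.trans hby.symm)⟩, hac⟩, hby⟩
    · exact Or.inr ⟨⟨⟨hab, fun h => hab (h.trans hbc.symm)⟩, hay⟩, hbc⟩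
  · rintro (⟨⟨⟨hab, -⟩, hac⟩, hby⟩ | ⟨⟨⟨hab, -⟩, hay⟩, hbc⟩)
    · exact ⟨hab, Or.inl ⟨hac, hby⟩⟩
    · exact ⟨hab, Or.inr ⟨hay, hbc⟩⟩

/-- the two crossing cells are disjoint. [this work] -/
theorem disjoint_X12 :
    Disjoint
      ((openConn a b)ᶜ ∩ (openConn a y)ᶜ ∩ openConn a c ∩ openConn b y :
        Set (BondConfig (Fin n)))
      ((openConn a b)ᶜ ∩ (openConn a c)ᶜ ∩ openConn a y ∩ openConn b c :
        Set (BondConfig (Fin n))) := by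
  rw [Set.disjoint_left]
  intro ω h1 h2
  exact absurd h1.1.2 h2.1.1.2

/-- `X′ = ac|b|y ⊔ ay|b|c` in the cell form of `crossPendant_exchange_sum`. [this work] -/
theorem evXp_eq :
    evXp a b c y =
      ((openConn a b)ᶜ ∩ (openConn a y)ᶜ ∩ openConn a c ∩ (openConn b y)ᶜ :
        Set (BondConfig (Fin n))) ∪
        ((openConn a b)ᶜ ∩ (openConn a c)ᶜ ∩ openConn a y ∩ (openConn b c)ᶜ :
        Set (BondConfig (Fin n))) := by
  ext ω
  simp only [evXp, mem_union, mem_inter_iff, mem_compl_iff, mem_openConn_iff']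
  constructor
  · rintro ⟨hab, ⟨⟨hac, hay⟩, hby⟩ | ⟨⟨hay, hac⟩, hbc⟩⟩
    · exact Or.inl ⟨⟨⟨hab, hay⟩, hac⟩, hby⟩
    · exact Or.inr ⟨⟨⟨hab, hac⟩, hay⟩, hbc⟩
  · rintro (⟨⟨⟨hab, hay⟩, hac⟩, hby⟩ | ⟨⟨⟨hab, hac⟩, hay⟩, hbc⟩)
    · exact ⟨hab, Or.inl ⟨⟨hac, hay⟩, hby⟩⟩
    · exact ⟨hab, Or.inr ⟨⟨hay, hac⟩, hbc⟩⟩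

/-- the two cells of `X′` are disjoint. [this work] -/
theorem disjoint_Xp12 :
    Disjoint
      ((openConn a b)ᶜ ∩ (openConn a y)ᶜ ∩ openConn a c ∩ (openConn b y)ᶜ :
        Set (BondConfig (Fin n)))
      ((openConn a b)ᶜ ∩ (openConn a c)ᶜ ∩ openConn a y ∩ (openConn b c)ᶜ :
        Set (BondConfig (Fin n))) := by
  rw [Set.disjoint_left]
  intro ω h1 h2
  exact absurd h1.1.2 h2.1.1.2

/-- `a|bcy` in the cell form of `crossPendant_exchange_sum` (`b~c ∧ b~y` ↔ `b~y ∧ c~y`). [this work] -/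
theorem evPend_eq :
    evPend a b c y =
      ((openConn a b)ᶜ ∩ (openConn a c)ᶜ ∩ (openConn a y)ᶜ ∩ openConn b y ∩ openConn c y :
        Set (BondConfig (Fin n))) := by
  ext ω
  simp only [evPend, mem_inter_iff, mem_compl_iff, mem_openConn_iff']
  constructor
  · rintro ⟨⟨⟨⟨hab, hac⟩, hay⟩, hbc⟩, hby⟩
    exact ⟨⟨⟨⟨hab, hac⟩, hay⟩, hby⟩, hbc.symm.trans hby⟩
  · rintro ⟨⟨⟨⟨hab, hac⟩, hay⟩, hby⟩, hcy⟩
    exact ⟨⟨⟨⟨hab, hac⟩, hay⟩, hby.trans hcy.symm⟩, hby⟩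

end cells


end Q44b

end Summit.CriticalPhenomena.PercolationContinuityZ3.Theorems

end
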